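import Summits.HodgeConjecture.HodgeConjecture.Theorems.AnchorTransportAnchorExistenceK3SquareCMFloorDecomposition
import Summits.HodgeConjecture.HodgeConjecture.Theorems.AnchorTransportAnchorExistenceK3SquareCMFloorEndomorphisms
import Literature.AlgebraicGeometry.Surfaces.K3ComplexMultiplication
import Literature.AlgebraicGeometry.Surfaces.K3HodgeTypesHolds
import Literature.AlgebraicGeometry.Surfaces.K3Marking
import Literature.NumberTheory.Transcendental.DeRhamTheoremMultiplicative

/-!
# Route AnchorTransport — `AnchorExistence` (stmt-HodgeConjecture-1077), line `Sketch`: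
# the CM floor on K3 squares (Buskin's corollary; Huybrechts 2019, Cor. 0.4 (ii))

Stub `anchorExistence_k3Square_floor_of_CM` of the lead skeleton of line `Sketch`: for a
projective K3 surface `S` with complex multiplication (`HasComplexMultiplication S`: some rational
Hodge endomorphism of `H²(S(ℂ); ℂ)` acts on `H^{2,0}` by a non-real scalar), every rational
`(2,2)`-class on `S ⊗ S` is algebraic — GRANTED Buskin's Thm. 1.1 (`hB`: rational Hodge
isometries of `H²` of K3 surfaces are algebraic), Lefschetz `(1,1)`, markings, `N¹H² ⊆ H^{1,1}`,
`b₁ = 0` and the Hodge index theorem. This is the printed three-line proof of the Corollary after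
Buskin's Thm. 1.1 (= Huybrechts 2019, Cor. 0.4 (ii)): (1) `End_Hdg(T(S)_ℚ)` is a CM field, hence
spanned over `ℚ` by Hodge isometries of `T(S)_ℚ` (Zarhin; Huybrechts' K3 book Thm. 3.3.7) — in the
tree on abstract carriers (`span_setOf_isometry_eq_top_of_conj_ne`), transported to the marking
picture by `…CMFloorTranscendental/Polarization/Span/Decomposition` (the transcendental lattice as
a polarized irreducible Hodge structure of K3 type, Huybrechts Ch. 3 Lemma 3.1); (2) an isometry of
`T` extended by the identity of `NS` is a rational Hodge isometry of `H²(S)`, hence `[γ]_*` with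
`γ` algebraic by `hB` (`anchorExistence_cmFloor_algebraicClass_of_endomorphism`: so EVERY rational
Hodge endomorphism of `H²(S)` is induced by an algebraic class — products of divisors for the
`NS`-part, Buskin classes for the isometries); (3) the Künneth bookkeeping "HC for `S²` ⟺ every
Hodge endomorphism algebraic" (Varesco 2023, p. 8;
`anchorExistence_cmFloor_mem_algebraicClasses_two_of_endomorphisms`).

## References

* [Buskin2019] N. Buskin, Every rational Hodge isometry between two K3 surfaces is algebraic,
  J. reine angew. Math. 755 (2019), Thm. 1.1 and the Corollary after it.
* [Huybrechts2019] D. Huybrechts, Motives of isogenous K3 surfaces, Comment. Math. Helv. 94 (2019),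
  Cor. 0.4 (ii) and Rem. 3.3.
* [Huybrechts2016K3] D. Huybrechts, Lectures on K3 Surfaces, CUP 2016, Ch. 3 Lemma 3.3.1, Thm. 3.3.7.
* [Varesco2023] M. Varesco, Hodge similitudes and the Hodge conjecture for squares of K3 surfaces
  (2023), §2 (p. 8).
-/

noncomputable section

set_option linter.dupNamespace false

open scoped Manifold
open Module CategoryTheory MonoidalCategory CartesianMonoidalCategory
open Literature.AlgebraicGeometry.Motives Literature.AlgebraicGeometry.HodgeTheory
open Literature.AlgebraicGeometry.Surfaces Literature.Geometry.Kaehler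
open Literature.AlgebraicTopology.SingularHomology

namespace Summit.HodgeConjecture.HodgeConjecture.Theorems

open Summit.HodgeConjecture.HodgeConjecture.Theorems.NikulinTwinTransport
open Summit.HodgeConjecture.HodgeConjecture.Theorems.AnchorExistenceCMFloor

variable {S : SchemeOver ℂ}

/-! ### Hodge endomorphisms of `H²(S)` read through a marking -/

/-- **Hodge endomorphisms of `H²(S)` read through a marking.** For a marked projective K3 surface
(`η`, the period `x` with `η⁻¹x` spanning `H^{2,0}`, `a ∪ b = (ηa.ηb) p₀`), a rational
type-preserving endomorphism `G` of `H²(S(ℂ); ℂ)` is `η⁻¹ ∘ φ_ℂ ∘ η` for a rational endomorphism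
`φ` of `Λ_ℚ` (`exists_ratEnd_of_forall_intCast`) whose complexification has `x` as an eigenvector
and preserves `{x, x̄}^⊥` (the `(1,1)`-classes are the classes orthogonal to `σ, σ̄`,
`Huybrechts_K3_hodgeTypes_H2`). [cite: Huybrechts2016K3, Ch. 3 §2.2 and Ch. 6 Prop. 1.2]
[cite: Buskin2019, §6.2, proof of Thm. 1.1] -/
theorem anchorExistence_cmFloor_exists_ratEnd (hHT : Huybrechts_K3_hodgeTypes_H2) (hS : IsK3Surface S)
    (η : complexBetti S (2 * 1) ≃ₗ[ℂ] (K3Index → ℂ)) (p₀ : complexBetti S (2 * 2)) (hp₀ : p₀ ≠ 0)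
    (hηint : ∀ c : complexBetti S (2 * 1), IsIntegralClass c ↔ ∃ v : K3Index → ℤ, η c = fun i => (v i : ℂ))
    (hηcup : ∀ a b : complexBetti S (2 * 1),
      cupProduct (rfl : 2 * 1 + 2 * 1 = 2 * 2) a b = k3Form (η a) (η b) • p₀)
    (x : K3Index → ℂ) (hx20 : IsOfHodgeType 2 S (2 * 1) 2 0 (η.symm x))
    (hx20' : ∀ τ : complexBetti S (2 * 1), IsOfHodgeType 2 S (2 * 1) 2 0 τ → ∃ t : ℂ, τ = t • η.symm x)
    (hxne : η.symm x ≠ 0)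
    (G : complexBetti S (2 * 1) →ₗ[ℂ] complexBetti S (2 * 1))
    (hG_rat : ∀ y, IsRationalClass y → IsRationalClass (G y))
    (hG_typ : ∀ (i j : ℕ) y, IsOfHodgeType 2 S (2 * 1) i j y → IsOfHodgeType 2 S (2 * 1) i j (G y)) :
    ∃ φ : Module.End ℚ (K3Index → ℚ), cxEnd φ = η.toLinearMap ∘ₗ G ∘ₗ η.symm.toLinearMap ∧
      (∃ c : ℂ, cxEnd φ x = c • x) ∧
      ∀ z : K3Index → ℂ, k3Form z x = 0 → k3Form z (star x) = 0 →
        k3Form (cxEnd φ z) x = 0 ∧ k3Form (cxEnd φ z) (star x) = 0 := by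
  set σ := η.symm x with hσdef
  have hησ : η σ = x := by rw [hσdef, LinearEquiv.apply_symm_apply]
  obtain ⟨-, -, h₃⟩ := hHT S hS σ hx20 hxne
  have hσbar : conjClass (ComplexPoints S) (2 * 1) σ = η.symm (star x) := conjClass_marking_symm η hηint x
  have hsmul0 : ∀ {c : ℂ}, c • p₀ = 0 → c = 0 := fun h => by
    rcases smul_eq_zero.1 h with h | h
    · exact h
    · exact absurd h hp₀
  have h11_iff : ∀ v : K3Index → ℂ, IsOfHodgeType 2 S (2 * 1) 1 1 (η.symm v) ↔
      (k3Form v x = 0 ∧ k3Form v (star x) = 0) := by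
    intro v
    rw [h₃ (η.symm v), hηcup, hηcup, LinearEquiv.apply_symm_apply, hησ, hσbar, LinearEquiv.apply_symm_apply]
    constructor
    · rintro ⟨ha, hb⟩
      exact ⟨hsmul0 ha, hsmul0 hb⟩
    · rintro ⟨ha, hb⟩
      rw [ha, hb, zero_smul]
      exact ⟨rfl, rfl⟩
  obtain ⟨φ, hφ⟩ := exists_ratEnd_of_forall_intCast (η.toLinearMap ∘ₗ G ∘ₗ η.symm.toLinearMap)
    (markingConj_intCast hS η hηint η hηint G hG_rat)
  have hM : cxEnd φ = η.toLinearMap ∘ₗ G ∘ₗ η.symm.toLinearMap := (eq_cxEnd_of_forall hφ).symm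
  have hMapp : ∀ v, cxEnd φ v = η (G (η.symm v)) := fun v => by rw [hM]; rfl
  refine ⟨φ, hM, ?_, fun v hvx hvx' => ?_⟩
  · obtain ⟨t, ht⟩ := hx20' _ (hG_typ 2 0 σ hx20)
    exact ⟨t, by rw [hMapp, ← hσdef, ht, map_smul, hησ]⟩
  · have hv11 : IsOfHodgeType 2 S (2 * 1) 1 1 (η.symm v) := (h11_iff v).2 ⟨hvx, hvx'⟩
    have hGv := hG_typ 1 1 _ hv11
    rw [← LinearEquiv.symm_apply_apply η (G (η.symm v)), h11_iff] at hGv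
    rw [hMapp]
    exact hGv

/-! ### Every rational Hodge endomorphism of `H²(S)` is algebraic, for `S` with complex multiplication -/

/-- **Every rational Hodge endomorphism of `H²(S)` of a projective K3 surface with complex
multiplication is induced by an algebraic class on `S × S`**, granted Buskin's Thm. 1.1 (`hB`),
markings, `Huybrechts_K3_hodgeTypes_H2`, `N¹H² ⊆ H^{1,1}`, Lefschetz `(1,1)` for `S` (`hL11`), the
non-degeneracy of the cup form on rational divisor classes (`hND`, Hodge index) and the Künneth
spanning property in the top degree (for the fibre integral `pr₁*pr₂^* p₀ = κ • 1`). Proof: read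
`F` on `Λ_ℚ` through a marking (`anchorExistence_cmFloor_exists_ratEnd`), decompose it by the CM
span theorem (`exists_sum_isometry`: rank-one divisor maps plus `Σ qⱼ ûⱼ` with `ûⱼ` Hodge
isometries of `Λ_ℚ`); the rank-one maps are induced by products of divisors
(`corrFst_cross_of_cup_eq`), and each `η⁻¹ ûⱼ η` is a rational Hodge isometry of `H²(S)`, hence
`[γⱼ]_*` with `γⱼ` algebraic by Buskin's theorem (with `S' = S`, `p' = p₀`, at the orientation
family `μ`, `OrientationFamily.hasPoincareDuality`). [cite: Buskin2019, Thm. 1.1 and the Corollary after it]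
[cite: Huybrechts2019, Cor. 0.4 (ii) and Rem. 3.3] -/
theorem anchorExistence_cmFloor_algebraicClass_of_endomorphism (hB : Buskin2019_hodgeIsometry_algebraic)
    (hmark : Huybrechts_K3_marking_exists) (hHT : Huybrechts_K3_hodgeTypes_H2)
    (hG : Grothendieck1969_supportedClasses_le_hodgeConiveau) (μ : OrientationFamily) (hS : IsK3Surface S)
    (hCM : HasComplexMultiplication S)
    (hKtop : ∀ z : complexBetti (S ⊗ S) (2 * (2 + 2)), z ∈ Submodule.span ℂ
      {v | ∃ (i j : ℕ) (h : i + j = 2 * (2 + 2)) (b : complexBetti S i) (w : complexBetti S j),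
        v = cupProduct h (complexBetti.map (fst S S) i b) (complexBetti.map (snd S S) j w)})
    (hL11 : ∀ c : complexBetti S (2 * 1), IsRationalClass c → IsOfHodgeType 2 S (2 * 1) 1 1 c →
      c ∈ algebraicClasses S 1)
    (hND : ∀ c ∈ algebraicClasses S 1, IsRationalClass c →
      (∀ d ∈ algebraicClasses S 1, cupProduct (rfl : 2 * 1 + 2 * 1 = 2 * 2) c d = 0) → c = 0)
    (F : complexBetti S (2 * 1) →ₗ[ℂ] complexBetti S (2 * 1))
    (hF_rat : ∀ y, IsRationalClass y → IsRationalClass (F y))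
    (hF_typ : ∀ (i j : ℕ) y, IsOfHodgeType 2 S (2 * 1) i j y → IsOfHodgeType 2 S (2 * 1) i j (F y)) :
    ∃ Γ ∈ algebraicClasses (S ⊗ S) 2, ∀ y : complexBetti S (2 * 1),
      F y = complexGysin μ (IsSmoothProjective.tensor_holds hS.1 hS.1) hS.1 (fst S S)
        (rfl : 2 * 1 + 2 * 2 + 2 * 2 = 2 * 1 + 2 * (2 + 2))
        (cupProduct (rfl : 2 * 1 + 2 * 2 = 2 * 1 + 2 * 2) (complexBetti.map (snd S S) (2 * 1) y) Γ) := by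
  classical
  obtain ⟨η, p₀, x, hp₀, ⟨hp₀int, hp₀gen, hηint, hηcup, hx20, hx20'⟩, hxx, hxpos, hu⟩ := hmark S hS
  set N := algebraicClasses S 1 with hNdef
  set σ := η.symm x with hσdef
  have hησ : η σ = x := by rw [hσdef, LinearEquiv.apply_symm_apply]
  have hxne : σ ≠ 0 := by
    intro h0
    have hx : x = 0 := by rw [← hησ, h0, map_zero]
    subst hx
    simp [k3Form] at hxpos
  obtain ⟨h₁, -, h₃⟩ := hHT S hS σ hx20 hxne
  have hσbar : conjClass (ComplexPoints S) (2 * 1) σ = η.symm (star x) := conjClass_marking_symm η hηint x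
  have hsmul0 : ∀ {c : ℂ}, c • p₀ = 0 → c = 0 := fun h => by
    rcases smul_eq_zero.1 h with h | h
    · exact h
    · exact absurd h hp₀
  -- rational classes are `Λ_ℚ`
  have hrat : ∀ c, IsRationalClass c ↔ ∃ w : K3Index → ℚ, η c = fun i => (w i : ℂ) :=
    isRationalClass_iff_of_marking hS η hηint
  -- the rational points of `N`
  let NQ : Submodule ℚ (K3Index → ℚ) :=
    { carrier := {u | η.symm (fun j => (u j : ℂ)) ∈ N}
      add_mem' := fun {u v} hu hv => by
        simp only [Set.mem_setOf_eq, ratCastΛ_add, map_add]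
        exact N.add_mem hu hv
      zero_mem' := by
        simp only [Set.mem_setOf_eq, ratCastΛ_zero, map_zero]
        exact N.zero_mem
      smul_mem' := fun q u hu => by
        simp only [Set.mem_setOf_eq, ratCastΛ_smul, map_smul]
        exact N.smul_mem _ hu }
  have memNQ : ∀ u, u ∈ NQ ↔ η.symm (fun j => (u j : ℂ)) ∈ N := fun u => Iff.rfl
  -- `(1,1)`-classes through the marking
  have h11_iff : ∀ v : K3Index → ℂ, IsOfHodgeType 2 S (2 * 1) 1 1 (η.symm v) ↔
      (k3Form v x = 0 ∧ k3Form v (star x) = 0) := by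
    intro v
    rw [h₃ (η.symm v), hηcup, hηcup, LinearEquiv.apply_symm_apply, hησ, hσbar, LinearEquiv.apply_symm_apply]
    constructor
    · rintro ⟨ha, hb⟩
      exact ⟨hsmul0 ha, hsmul0 hb⟩
    · rintro ⟨ha, hb⟩
      rw [ha, hb, zero_smul]
      exact ⟨rfl, rfl⟩
  -- `N_ℚ = Λ_ℚ ∩ {x, x̄}^⊥`
  have hN : ∀ u : K3Index → ℚ, u ∈ NQ ↔
      (k3Form (fun i => (u i : ℂ)) x = 0 ∧ k3Form (fun i => (u i : ℂ)) (star x) = 0) := by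
    intro u
    rw [memNQ, ← h11_iff]
    constructor
    · intro hu
      exact NikulinTwinTransport.isOfHodgeType_oneOne_of_mem_algebraicClasses hG hS hu
    · intro hu
      exact hL11 _ ((hrat _).2 ⟨u, LinearEquiv.apply_symm_apply _ _⟩) hu
  -- `N` is spanned by its rational classes, so `N_ℚ^⊥ ⊗ ℂ ⊥ N`
  have hspan := span_isRationalClass_eq_top_of_isSmoothProjective_holds.supportedClasses_eq_span
    hS.1 (2 * 1) 1
  have horth : ∀ u ∈ k3FormRat.orthogonal NQ, ∀ d ∈ N, k3Form (fun j => (u j : ℂ)) (η d) = 0 := by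
    intro u hu d hd
    rw [LinearMap.BilinForm.mem_orthogonal_iff] at hu
    have hd' : d ∈ Submodule.span ℂ {c : complexBetti S (2 * 1) |
        IsRationalClass c ∧ c ∈ supportedClasses S (2 * 1) 1} := by
      rw [← hspan]; exact hd
    clear hd
    induction hd' using Submodule.span_induction with
    | mem d hd =>
      obtain ⟨w, hw⟩ := (hrat d).1 hd.1
      have hwN : w ∈ NQ := by
        rw [memNQ, ← hw, LinearEquiv.symm_apply_apply]
        exact hd.2
      rw [hw, k3Form_ratCast, k3FormRat_isSymm.eq, hu w hwN, Rat.cast_zero]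
    | zero => rw [map_zero, k3Form_zero_right]
    | add c c' _ _ hc hc' => rw [map_add, k3Form_add_right, hc, hc', add_zero]
    | smul t c _ hc => rw [map_smul, k3Form_smul_right, hc, mul_zero]
  -- `N_ℚ ∩ N_ℚ^⊥ = 0` (Hodge index)
  have hdisj : Disjoint NQ (k3FormRat.orthogonal NQ) := by
    rw [Submodule.disjoint_def]
    intro u huN huT
    have hc0 : η.symm (fun j => (u j : ℂ)) = 0 :=
      hND _ ((memNQ u).1 huN) ((hrat _).2 ⟨u, LinearEquiv.apply_symm_apply _ _⟩) fun d hd => by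
        rw [hηcup, LinearEquiv.apply_symm_apply, horth u huT d hd, zero_smul]
    apply ratCastΛ_injective
    rw [ratCastΛ_zero]
    exact η.symm.injective (hc0.trans (map_zero _).symm)
  -- the CM witness
  obtain ⟨ψ, hψrat, hψtyp, σ', μ', hσ'typ, hσ'0, hμ', hψσ'⟩ := hCM
  obtain ⟨φ₀, hφ₀M, -, hφ₀11⟩ := anchorExistence_cmFloor_exists_ratEnd hHT hS η p₀ hp₀ hηint hηcup x hx20 hx20' hxne
    ψ hψrat hψtyp
  have hφ₀x : cxEnd φ₀ x = μ' • x := by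
    obtain ⟨t, ht⟩ := (h₁ σ').1 hσ'typ
    have ht0 : t ≠ 0 := by
      rintro rfl
      rw [zero_smul] at ht
      exact hσ'0 ht
    have hψσ : ψ σ = μ' • σ := by
      have h : t • ψ σ = t • (μ' • σ) := by
        rw [← map_smul, smul_comm, ← ht]
        exact hψσ'
      exact smul_right_injective _ ht0 h
    rw [hφ₀M, LinearMap.comp_apply, LinearMap.comp_apply, LinearEquiv.coe_coe, LinearEquiv.coe_coe, ← hσdef]
    change η (ψ σ) = μ' • x
    rw [hψσ, map_smul, hησ]
  -- the decomposition of `F`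
  obtain ⟨φ, hφM, hφx, hφ11⟩ := anchorExistence_cmFloor_exists_ratEnd hHT hS η p₀ hp₀ hηint hηcup x hx20 hx20' hxne
    F hF_rat hF_typ
  obtain ⟨m, aQ, bQ, k, q, υ, haQ, hbQ, hυ, hdec⟩ :=
    exists_sum_isometry hN hdisj hxx hxpos hu φ₀ μ' hμ' hφ₀x hφ₀11 φ hφx hφ11
  -- Buskin for each isometry `ûⱼ`
  have hΦ : ∀ j, ∃ γ ∈ algebraicClasses (S ⊗ S) 2, ∀ y : complexBetti S (2 * 1),
      η.symm (cxEnd (υ j) (η y)) = complexGysin μ (IsSmoothProjective.tensor_holds hS.1 hS.1) hS.1 (fst S S)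
        (rfl : 2 * 1 + 2 * 2 + 2 * 2 = 2 * 1 + 2 * (2 + 2))
        (cupProduct (rfl : 2 * 1 + 2 * 2 = 2 * 1 + 2 * 2) (complexBetti.map (snd S S) (2 * 1) y) γ) := by
    intro j
    obtain ⟨hiso, ⟨c, hc⟩, h11⟩ := hυ j
    let Φ : complexBetti S (2 * 1) →ₗ[ℂ] complexBetti S (2 * 1) :=
      η.symm.toLinearMap ∘ₗ cxEnd (υ j) ∘ₗ η.toLinearMap
    have hΦapp : ∀ y, Φ y = η.symm (cxEnd (υ j) (η y)) := fun y => rfl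
    have hΦrat : ∀ y, IsRationalClass y → IsRationalClass (Φ y) := by
      intro y hy
      obtain ⟨w, hw⟩ := (hrat y).1 hy
      rw [hΦapp, hw, cxEnd_ratCast]
      exact (hrat _).2 ⟨υ j w, LinearEquiv.apply_symm_apply _ _⟩
    have hΦtyp : ∀ (i j : ℕ) y, IsOfHodgeType 2 S (2 * 1) i j y → IsOfHodgeType 2 S (2 * 1) i j (Φ y) := by
      refine typePreserving_of_lines hHT hS hx20 hxne Φ ⟨c, ?_⟩ ⟨star c, ?_⟩ fun v hv => ?_
      · rw [hΦapp, hησ, hc, map_smul, hσdef]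
      · rw [hσbar, hΦapp, LinearEquiv.apply_symm_apply, cxEnd_star, hc, star_smul, map_smul]
      · have hv' := hv
        rw [← LinearEquiv.symm_apply_apply η v, h11_iff] at hv'
        rw [hΦapp, h11_iff]
        exact h11 (η v) hv'.1 hv'.2
    have hΦiso : ∀ (a b : complexBetti S (2 * 1)) (t : ℂ),
        cupProduct (rfl : 2 * 1 + 2 * 1 = 2 * 2) a b = t • p₀ →
          cupProduct (rfl : 2 * 1 + 2 * 1 = 2 * 2) (Φ a) (Φ b) = t • p₀ := by
      intro a b t hab
      rw [hηcup, hΦapp, hΦapp, LinearEquiv.apply_symm_apply, LinearEquiv.apply_symm_apply, k3Form_cxEnd _ hiso,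
        ← hηcup, hab]
    obtain ⟨γ, hγ, hΦγ⟩ := hB μ (OrientationFamily.hasPoincareDuality μ) S S hS hS p₀ p₀ ⟨hp₀int, hp₀gen⟩
      ⟨hp₀int, hp₀gen⟩ Φ hΦrat hΦtyp hΦiso
    exact ⟨γ, hγ, fun y => hΦγ y⟩
  choose γ hγalg hγact using hΦ
  -- the rank-one part: products of divisors
  obtain ⟨κ, hκ0, hκ⟩ := exists_fibreIntegral_fst μ hS.1 hS.1 hKtop hp₀ (rfl : 2 * 2 + 2 * 2 = 0 + 2 * (2 + 2))
  set α : Fin m → complexBetti S (2 * 1) := fun i => η.symm fun j => (aQ i j : ℂ) with hαdef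
  set β : Fin m → complexBetti S (2 * 1) := fun i => η.symm fun j => (bQ i j : ℂ) with hβdef
  set γ₁ : Fin m → complexBetti (S ⊗ S) (2 * 2) := fun i => cupProduct (rfl : 2 * 1 + 2 * 1 = 2 * 2)
    (complexBetti.map (fst S S) (2 * 1) (β i)) (complexBetti.map (snd S S) (2 * 1) (α i)) with hγ₁def
  have hγ₁alg : ∀ i, γ₁ i ∈ algebraicClasses (S ⊗ S) 2 := fun i =>
    cupProduct_fst_snd_mem_algebraicClasses_of_eq hS.1 hS.1 ((memNQ _).1 (hbQ i)) ((memNQ _).1 (haQ i))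
      (rfl : 1 + 1 = 2) _
  refine ⟨∑ i, κ⁻¹ • γ₁ i + ∑ j, (q j : ℂ) • γ j, ?_, fun y => ?_⟩
  · exact Submodule.add_mem _ (Submodule.sum_mem _ fun i _ => Submodule.smul_mem _ _ (hγ₁alg i))
      (Submodule.sum_mem _ fun j _ => Submodule.smul_mem _ _ (hγalg j))
  · -- `F y` through the marking
    have hFy : F y = η.symm (cxEnd φ (η y)) := by
      rw [hφM, LinearMap.comp_apply, LinearMap.comp_apply, LinearEquiv.coe_coe, LinearEquiv.coe_coe,
        LinearEquiv.symm_apply_apply, LinearEquiv.symm_apply_apply]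
    have hcx : cxEnd φ = (∑ i, ((k3FormC.flip (fun j => (aQ i j : ℂ))).smulRight (fun j => (bQ i j : ℂ)))) +
        ∑ j, (q j : ℂ) • cxEnd (υ j) := by
      symm
      refine eq_cxEnd_of_forall fun v => ?_
      rw [hdec v, ratCastΛ_add, ratCastΛ_sum, ratCastΛ_sum]
      simp only [LinearMap.add_apply, LinearMap.sum_apply, LinearMap.smulRight_apply, LinearMap.BilinForm.flip_apply,
        k3FormC_apply, k3Form_ratCast, ratCastΛ_smul, cxEnd_ratCast, LinearMap.smul_apply]
    have hcoef : ∀ i, cupProduct (rfl : 2 * 1 + 2 * 1 = 2 * 2) y (α i) =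
        k3Form (η y) (fun j => (aQ i j : ℂ)) • p₀ := fun i => by
      rw [hηcup, hαdef, LinearEquiv.apply_symm_apply]
    have hγ₁act : ∀ i, complexGysin μ (IsSmoothProjective.tensor_holds hS.1 hS.1) hS.1 (fst S S)
        (rfl : 2 * 1 + 2 * 2 + 2 * 2 = 2 * 1 + 2 * (2 + 2))
        (cupProduct (rfl : 2 * 1 + 2 * 2 = 2 * 1 + 2 * 2) (complexBetti.map (snd S S) (2 * 1) y) (γ₁ i)) =
        (k3Form (η y) (fun j => (aQ i j : ℂ)) * κ) • β i := fun i => by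
      rw [hγ₁def, corrFst_cross_of_cup_eq μ hS.1 hS.1 (rfl : 2 * 1 + 2 * 1 = 2 * 2) _
        (rfl : 2 * 1 + 2 * 1 = 2 * 2) _ (rfl : 2 * 2 + 2 * 2 = 0 + 2 * (2 + 2)) hκ (β i) (hcoef i)]
      norm_num
    rw [hFy, hcx]
    simp only [LinearMap.add_apply, LinearMap.sum_apply, LinearMap.smulRight_apply, LinearMap.BilinForm.flip_apply,
      k3FormC_apply, LinearMap.smul_apply, map_add, map_sum, map_smul, hγact, hγ₁act, smul_smul]
    congr 1
    refine Finset.sum_congr rfl fun i _ => ?_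
    congr 1
    field_simp

/-! ### The stub: the CM floor on K3 squares -/

/-- **K3-square floor, CM case (Buskin's corollary; Huybrechts 2019, Cor. 0.4 (ii))**: for a
projective K3 surface `S` with complex multiplication every rational `(2,2)`-class on `S ⊗ S` is
algebraic, granted Buskin's Thm. 1.1 (`hB`), Lefschetz `(1,1)`, K3 markings, `NᵖHⁱ ⊆ Fᵖ`, odd
Betti vanishing and the Hodge index theorem. Printed proof: `End_Hdg(T(S)_ℚ)` is a CM field,
hence spanned over `ℚ` by Hodge isometries (Zarhin; Huybrechts' K3 book Thm. 3.3.7), which are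
algebraic by Thm. 1.1; so every Hodge endomorphism of `H²(S)` is algebraic
(`anchorExistence_cmFloor_algebraicClass_of_endomorphism`), and the remaining Hodge classes on
`S × S` are Künneth factors and products of divisors
(`anchorExistence_cmFloor_mem_algebraicClasses_two_of_endomorphisms`, Varesco 2023 p. 8); the
Künneth spanning property, de Rham, the independence of Hodge types from the model and
`Huybrechts_K3_hodgeTypes_H2` are the tree's theorems. [cite: Huybrechts2019, Cor. 0.4 (ii) and Rem. 3.3]
[cite: Buskin2019, Thm. 1.1 and the Corollary after it] [cite: Varesco2023, §2 (p. 8)]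
[cite: Huybrechts2016K3, Thm. 3.3.7] -/
theorem anchorExistence_k3Square_floor_of_CM (hB : Buskin2019_hodgeIsometry_algebraic)
    (hL : lefschetzOneOne_rational)
    (hmark : Huybrechts_K3_marking_exists) (hG : Grothendieck1969_supportedClasses_le_hodgeConiveau)
    (hodd : Huybrechts_K3_oddBetti_vanish) (hHI : ∀ S : SchemeOver ℂ, hodgeIndex_surface S) :
    ∀ S : SchemeOver ℂ, IsK3Surface S → HasComplexMultiplication S →
      ∀ c : complexBetti (S ⊗ S) (2 * 2), IsRationalClass c → IsOfHodgeType 4 (S ⊗ S) (2 * 2) 2 2 c →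
        c ∈ algebraicClasses (S ⊗ S) 2 := by
  intro S hS hCM c hc hct
  have hI : hodgePQ_independent_of_hodgeModel := hodgePQ_independent_of_hodgeModel_holds
  have hHT : Huybrechts_K3_hodgeTypes_H2 := Huybrechts_K3_hodgeTypes_H2_holds
  have hdR : ∀ (E : Type) [NormedAddCommGroup E] [NormedSpace ℂ E] [FiniteDimensional ℂ E],
      Literature.NumberTheory.Transcendental.exists_deRhamIsoFamily 𝓘(ℝ, E) :=
    fun E _ _ _ => Literature.NumberTheory.Transcendental.exists_deRhamIsoFamily_holds (E := E)
  let μ : OrientationFamily := fun _ _ h ↦ Classical.choice (ComplexPoints.isOrientableOver ℂ h)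
  obtain ⟨h1, h3⟩ := hodd S hS
  have hL11 : ∀ c : complexBetti S (2 * 1), IsRationalClass c → IsOfHodgeType 2 S (2 * 1) 1 1 c →
      c ∈ algebraicClasses S 1 := fun c hc h11 => hL hS.1 c hc h11
  have hND : ∀ c ∈ algebraicClasses S 1, IsRationalClass c →
      (∀ d ∈ algebraicClasses S 1, cupProduct (rfl : 2 * 1 + 2 * 1 = 2 * 2) c d = 0) → c = 0 :=
    fun c hcN hc hperp => anchorExistence_cmFloor_divisorClass_eq_zero_of_hodgeIndex (hHI S) hL hG hS hcN hc hperp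
  exact anchorExistence_cmFloor_mem_algebraicClasses_two_of_endomorphisms hI hdR μ hS
    (Hatcher2002_crossProducts_span_complexBetti_holds hS.1 hS.1 (2 * 2))
    (Hatcher2002_crossProducts_span_complexBetti_holds hS.1 hS.1 _) h1 h3
    (fun F hF_rat hF_typ => anchorExistence_cmFloor_algebraicClass_of_endomorphism hB hmark hHT hG μ hS hCM
      (Hatcher2002_crossProducts_span_complexBetti_holds hS.1 hS.1 _) hL11 hND F hF_rat hF_typ)
    c hc hct

end Summit.HodgeConjecture.HodgeConjecture.Theorems

end
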